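/-
Copyright (c) 2026 the pub-hodgecm-mathlib formalisation cell (harness21).  Prover seat hodgecm-mathlib-LA2-p02 (g7), organ payer of half-A line L2
(«M-152» SEQUEL ★ chain, part F4; map LA2-p03 (g9) 2026-09-03T05:57Z), 2026-09-03.  THEOREMS ONLY (no definition, no named fact, no `sorry`, no instance,
no notation).  `--supports stmt-HodgeConjecture-24832 --as helper`.
-/
import Summits.HodgeConjecture.CorCM.HypLiu418.A3Liu418FaceTypes
import Summits.HodgeConjecture.CorCM.HypLiu418.A3Liu418GSFrobeniusOfThmD6
import Summits.HodgeConjecture.HodgeConjecture.Theorems.A3Liu418Mult1AtFace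
import Summits.HodgeConjecture.HodgeConjecture.Theorems.A3Liu418S34OfGS
import Literature.AlgebraicGeometry.ShimuraVarieties.UnitaryBallH1RestrictionToSpecialCurvesHolds
import Literature.NumberTheory.Automorphic.Liu2021.AppendixC.Thm415PinnedOfFrobenius
import Literature.NumberTheory.Automorphic.Liu2021.AppendixC.OmegaHomPullback
import Literature.NumberTheory.Automorphic.Liu2021.AppendixC.SeesawSource
import HarnessLib

/-!
# F4 — [Liu2021, Thm. 4.15] PINNED AT THE FACE from the one-curve statement [Liu2021, Thm. D.6 (1)] (`thmD6OneCurveCUF`) and the route item `H413`,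
# Theorems-side (importable), sorry-free — the `Lines/a3_liu418` face glue as ONE theorem

Cell hodgecm-mathlib FLOOR 0, programme P6, crux `hLiu418` = `stmt-HodgeConjecture-24832`; «M-152» SEQUEL ★ chain (LA2-p03 (g9) map 2026-09-03T05:57Z:
F1 ★ `F0P6LD1StubS1FactsOfA2P` #73-of-letter, F2 ★ `F0P6LD2StubS1bFactsOfA2P` #74R-of-letter, F3 the F0 folds → `thmD6OneCurveCUF`-of-letter, **F4 = this file**,
F5 the ★ conditional closer `HLiu418_of_h415 (F4 (F3 h♮) h413) h21 h413` of `…HCCMUnconditional.HLiu418` from ONE printed letter + the route items).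
Namespace `Summit.HodgeConjecture.HodgeConjecture.Cruxes.HLiu418.A3Liu418Thm415AtFaceOfThmD6`.

WHAT IS PROVED (one closed theorem, axioms TRIO):
* `thm415AtFace_of_thmD6 : thmD6OneCurveCUF → HCCMUnconditional.H413 → Thm415AtFace` — the registry `Lines/a3_liu418.lean` (v22) composition
  `stub_thm415AtFace h413 := thm415AtFace_of_R0_S stub_R0_frobeniusToPinned (thm415FrobeniusAtFace_of_split (stub_MULT1 h413) stub_S34 stub_S5)` with its
  `stub_D6 : thmD6OneCurveCUF` (the registry's one `sorry`, :631) turned into the HYPOTHESIS `hD6`, written as ONE tactic proof over the ★ sources so that NONE of the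
  registry's face-closure `def`s (`S5Transfer`, `Thm415Frobenius`, `R0FrobeniusToPinned`, `Thm415FrobeniusAtFace`, `FacePin`∕`FacePinData`, `Mult1AtFace`, `S34AtFace` —
  `Lines` decls, consumed by nobody here) needs a Theorems twin: (R0) ★ `AppendixC.thm415Pinned_of_frobenius` at the face object `obj ∈ 𝒜(ν)` (its Frobenius-form CM
  hypothesis discharged by `Def45.IsCMCharacterMuAlgHecke.isCMCharacterMuAlg` on `RestOne.datum … obj`, as in `thm415AtFace_of_R0_S` :675), then the generic glue of
  `thm415Frobenius_of_split` (:462) inlined at the face: MULT1 ★ `mult1AtFace_of_h413 h413` (A-p09 k21, p650508), S34 ★ `s34SomeSource_CV_of_GS'` (A-p09 GS-8 ed. 2,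
  p706204) fed III-8′ ★ `UnitaryBallUniformisationDatum.mr92Prop6Source` and GS-6 ★ `frobeniusActsByGS_of_thmD6 hD6` (the (β) decomposition road, p748737), S5 ★
  `AppendixC.towerRep_eq_smul_of_span_of_pull_ne_zero` (A-p18 k19).  The seesaw-source PIN is taken TRIVIAL (`Pin := ⊤`): the registry pins the source to exclude junk from
  the REGISTERED HYPOTHESIS `S34AtFace`; here S34 is DERIVED (from GS-6), so the pin restricts nothing the proof uses.

HONEST SCOPE.  This file BOOKS NOTHING: no registered stub of `a3_liu418` ∕ `d6_cm_curve` ∕ `F0_AlbCm` is touched, no printed citation is discharged; it makes the implication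
«[Thm. D.6 (1)] for one curve + [Prop. 4.13] (route item `H413`) ⇒ [Thm. 4.15] pinned at the face» a kernel-checked ★ theorem importable from `Theorems/` (F5 consumes it).
HC_CM is proved only modulo the 7 printed citations (2 remaining: hLiu418 = stmt-HodgeConjecture-24832, h413 = stmt-HodgeConjecture-24833) until rung 0 closes.

## References
* [Liu2021] Y. Liu, Camb. J. Math. 9 (2021) = arXiv:2102.11518: Thm. 4.15 (FJcycle.tex l. 2177–2182) and its proof p. 51 (l. 2185–2213, fn. 9); Prop. 4.13 (l. 2110–2131);
  §4.2 (l. 2162–2174); Def. 4.5 (2) (l. 1952); App. D Rem. D.5 (p. 131), Thm. D.6 (1) (p. 132), Prop. D.8 (p. 135), Cor. D.9 (p. 138).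
* [MurtyRamakrishnan1992] V. K. Murty, D. Ramakrishnan, §5 Prop. 6 p. 460, Lemma A p. 461, Lemma B p. 462.
* [SerreTate1968] J.-P. Serre, J. Tate, Ann. of Math. 88 (1968), §1, §7 Thm. 10–11 (Frobenius density step of (R0), context).
* [Milne2005ShimuraVarieties] J. Milne, Clay Math. Proc. 4 (2005), Thm. 13.6 p. 118 (morphisms of Shimura varieties, the seesaw source).
-/

set_option autoImplicit false
-- the mandated namespace has the single-problem summit's repeated segment (`HodgeConjecture.HodgeConjecture`)
set_option linter.dupNamespace false

noncomputable section

namespace Summit.HodgeConjecture.HodgeConjecture.Cruxes.HLiu418.A3Liu418Thm415AtFaceOfThmD6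

open scoped TensorProduct Matrix
open NumberField NumberField.InfinitePlace
open HodgeCM.Model HodgeCM.Model.LiuIndex HodgeCM.Model.TowerCarrier
open Summit.HodgeConjecture.CorCM.Model
open Literature.AlgebraicGeometry.Motives (CMType AbelianVariety)
open Literature.AlgebraicGeometry.ShimuraVarieties.UnitaryCanonicalModel
open Literature.NumberTheory.ComplexMultiplication
open Literature.NumberTheory.Automorphic
open Literature.NumberTheory.Automorphic.Liu2021 Literature.NumberTheory.Automorphic.Liu2021.AppendixC
open Literature.NumberTheory.Automorphic.Liu2021.AppendixC.RestOne
open Literature.AlgebraicGeometry.Liu2021 (IsAdmissibleElement)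
open Summit.HodgeConjecture.CorCM.Lines.A3Liu418
open Summit.HodgeConjecture.CorCM.HypLiu418

set_option synthInstance.maxHeartbeats 400000 in
set_option maxHeartbeats 8000000 in
-- (the face-closure statements `Thm415AtFace` ∕ `Thm415Pinned` and the ★ heads `mult1AtFace_of_h413` ∕ `s34SomeSource_CV_of_GS'` are 20-binder telescopes over the
--  model՚s `CV ∕ UV ∕ TV` carriers; the budget is the registry՚s own for the same glue split in two (`a3_liu418` :553–:690))
/-- **[Liu2021, Thm. 4.15] PINNED AT THE FACE (`Thm415AtFace`) from [Thm. D.6 (1)] for the one curve (`hD6 : thmD6OneCurveCUF`) and the route item `H413`.**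
For every canonical-model datum `hDel`, every face `(F, ι₁, V, a, Φ)` with `ι₁ ∈ Φ` and `[F:ℚ] ≥ 6`, every conjugate-symplectic weight-one `ν`, every `(ℓ, ι′)`, every object
`obj ∈ 𝒜(ν)` and every étale Hecke datum `X` induced by the Albanese translates `T_V`, the Galois group acts on the `ω(ν,ε,χ)`-Hom-space of `ℚ̄_ℓ ⊗ H¹_ét(Sh(V)_∞)`
through `ν^{alg}` read on `(A_ν, i_ν)` (`Thm415Pinned`).  PROOF (the `a3_liu418` v22 registry composition `stub_thm415AtFace`, its one `sorry` `stub_D6` made the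
hypothesis): (R0) ★ `thm415Pinned_of_frobenius` «Frobenius-dense ⇒ all σ» at `(A_ν, i_ν) := RestOne.AμOne ∕ iOne … obj`, CM hypothesis by
`Def45.IsCMCharacterMuAlgHecke.isCMCharacterMuAlg`; its Frobenius-form input is glued exactly as `thm415Frobenius_of_split`: fix `(ε, χ)`; if the Hom-space is zero take
`S := ∅`; else pick `f₀ ≠ 0`, S34 (★ `s34SomeSource_CV_of_GS'` over III-8′ ★ `mr92Prop6Source` and GS-6 ★ `frobeniusActsByGS_of_thmD6 hD6`, trivial pin) gives a seesaw
source `s` with `pull f₀ ≠ 0` whose Frobenii act by `(ι′ ν^{alg}(ϖ_v))⁻¹` off a finite `S`; S5 (★ `towerRep_eq_smul_of_span_of_pull_ne_zero`) transfers the scalar to `f₀`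
(MULT1 ★ `mult1AtFace_of_h413 h413` = «`f₀` spans»), and every `f = b • f₀` follows by linearity.
[cite: Liu2021, Thm. 4.15 (FJcycle.tex l. 2177–2182), proof p. 51 (l. 2185–2213) with fn. 9; Prop. 4.13 (l. 2110–2131); Def. 4.5 (2) (l. 1952); App. D Thm. D.6 (1) p. 132, Rem. D.5 p. 131]
[cite: MurtyRamakrishnan1992, §5 Prop. 6 p. 460] [cite: Milne2005ShimuraVarieties, Thm. 13.6 p. 118] [cite: SerreTate1968, §1] -/
theorem thm415AtFace_of_thmD6 (hD6 : thmD6OneCurveCUF)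
    (h413 : Summit.HodgeConjecture.HodgeConjecture.Theses.HCCMUnconditional.H413) : Thm415AtFace := by
  intro hDel F _ h6 ι₁ V a Φ hΦ ν hν hw ℓ _ X ι' obj hX
  refine thm415Pinned_of_frobenius (CV hDel F V Φ) (UV hDel F V a Φ) ℓ X ι' ν hν
    (RestOne.AμOne (AlgHom.id ℚ _) ι₁ hν hw (CarN F ι₁ ν hν) obj) (RestOne.iOne (AlgHom.id ℚ _) ι₁ hν hw (CarN F ι₁ ν hν) obj)
    (Def45.IsCMCharacterMuAlgHecke.isCMCharacterMuAlg (RestOne.datum (AlgHom.id ℚ _) ι₁ hν hw (CarN F ι₁ ν hν) obj).isCMCharacter) ?_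
  -- [Thm 4.15] in Frobenius form at the face: MULT1 (`h413`) + S34 (GS-6 of `hD6`, III-8′) + S5, glued as in the registry's `thm415Frobenius_of_split`
  intro hn hw' ε hε χ
  classical
  by_cases h0 : ∀ f ∈ X.omegaHom ι' ((UV hDel F V a Φ).rho ν hν ε χ), f = 0
  · refine ⟨∅, Set.finite_empty, ?_⟩
    intro v _ 𝔓 _ σ _ f hf w
    rw [h0 f hf]
    simp
  · push Not at h0
    obtain ⟨f₀, hf₀, hne⟩ := h0
    -- MULT1 at the face from the route item `H413` (★ A-p09 k21)
    have h1 := mult1AtFace_of_h413 h413 hDel F h6 V a Φ hΦ ν hν hw ℓ X ι' hX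
    -- S34 at the face from III-8′ (★ MR92 Prop. 6 on the ball) and GS-6 derived from `hD6` (★ (β) road); the seesaw-source pin is trivial here
    have h34 := s34SomeSource_CV_of_GS'
      (fun D => Literature.AlgebraicGeometry.ShimuraVarieties.UnitaryBallUniformisationDatum.mr92Prop6Source D)
      (frobeniusActsByGS_of_thmD6 hD6) hDel F h6 V a Φ hΦ ν hν hw ℓ X ι' hX (fun _ _ => True)
      (fun _ _ _ _ _ _ _ _ _ => trivial)
    obtain ⟨s, hs, S, hSfin, hS⟩ := h34 hn hw' ε hε χ f₀ hf₀ hne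
    refine ⟨S, hSfin, ?_⟩
    intro v hv 𝔓 h𝔓 σ hσ f hf w
    obtain ⟨b, rfl⟩ := h1 hn hw' ε hε χ f₀ hf₀ f hf hne
    -- S5: transfer the Frobenius scalar from the source Hom-space to `f₀` (★ A-p18 k19)
    have key := towerRep_eq_smul_of_span_of_pull_ne_zero s.Cₛ (CV hDel F V Φ) s.Tₛ (TV hDel F h6 V Φ) s.φ s.hφ s.hK₀
      s.M.toEtaleTowerHom ℓ X s.Xₛ hX s.hXₛ ι' ((UV hDel F V a Φ).rho ν hν ε χ) σ _ f₀ hf₀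
      (fun g hg => h1 hn hw' ε hε χ f₀ hf₀ g hg hne) hs (hS v hv 𝔓 h𝔓 σ hσ) w
    rw [LinearMap.smul_apply, map_smul, key, smul_comm]

end Summit.HodgeConjecture.HodgeConjecture.Cruxes.HLiu418.A3Liu418Thm415AtFaceOfThmD6

end
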